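import Literature.Probability.Percolation.InterfaceTraversalBound
import HarnessLib

/-!
# Multiple shell crossings by the bond interface of ARBITRARY discrete Dobrushin data, I:
the perturbed polygon and the boundary of the Jordan domain

Topic: Probability / Percolation. `InterfaceTraversalBound.lean` proves Aizenman–Burchard's
hypothesis H1 (Duke Math. J. 99 (1999), eq. (1.3), Appendix A) and the tightness of the
interface laws (AB99 Thm 1.2) for the medial exploration path of critical bond percolation on
`δℤ²` in the **canonical** discretisation `dobrushinData D δ = ⟨D, δ, (ab), (ba)⟩` of a Jordan
Dobrushin domain `D`. Scaling-limit statements quantified over discretisation FAMILIES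
(`ZdDiscretisationFamily D E`: domain `D`, mesh `δ`, but *arbitrary* wired / dual-wired arcs
`arcA`, `arcB`, admissible for small `δ`) need the same facts for arbitrary data
`⟨D, δ, arcA, arcB⟩`. The canonical proofs never use the arcs of the data beyond the generic
`DiscreteDobrushin` interface (`zdArcA`, `zdArcB`, `zdBoundary`, `IsZdAdmissible`), so they go
through VERBATIM; this file and its sequels (`InterfaceTraversalBoundData2/3/4.lean`) carry them
out for the data `⟨D.carrier, δ, arcA, arcB⟩` with `arcA arcB : Set ℂ` free (written as the
structure literal, so that `.Ω` and `.δ` compute to `D.carrier` and `δ` exactly as for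
`dobrushinData`).

This file: Part II of `InterfaceTraversalBound.lean`, first half — inner faces, vertex
connectors and the perturbed polygon lie inside the domain (`pertTrace_subset_carrier_data`,
`pertTrace_disjoint_frontier_data`), and every discrete boundary site is joined to the boundary
curve, within `2δ`, off the polygon (`exists_frontier_near_of_mem_zdBoundary_data`). The names
are those of the canonical lemmas with the suffix `_data`; the proofs are theirs.

References: M. Aizenman, A. Burchard, Duke Math. J. 99 (1999) 419–453, Appendix A;
S. Smirnov, C. R. Acad. Sci. Paris 333 (2001), §2; F. Camia, C. M. Newman, PTRF 139 (2007), §2.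
-/

noncomputable section

open Set Metric Complex
open scoped Pointwise

namespace Literature.Probability.Percolation

open LatticeModels LatticeModels.IsMedialExploration

variable {Dm : RandomPlanarGeometry.DobrushinDomain} {δ : ℝ} {arcA arcB : Set ℂ}
  {ω : BondConfig (Site 2)} {a : MedialVertex} {l : List MedialVertex}

/-! ### Inner faces and the perturbed polygon lie inside the domain -/

/-- An edge of `Ω_δ` is a lattice segment in `closure D` (arbitrary arcs). [cite: Smirnov2001, §2] -/
theorem segment_subset_closure_of_adj_data {u w : Site 2}
    (h : (discreteDomainGraph (⟨Dm.carrier, δ, arcA, arcB⟩ : DiscreteDobrushin).Ω (⟨Dm.carrier, δ, arcA, arcB⟩ : DiscreteDobrushin).δ).Adj u w) :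
    segment ℝ (meshPoint δ u) (meshPoint δ w) ⊆ closure Dm.carrier :=
  (meshGraph_adj_iff.1 (discreteDomainGraph_adj_iff.1 h).1).2

/-- **A point on a side of an inner face lies in `closure D`** (arbitrary arcs): in lattice
units the point has `j`-coordinate `f j` or `f j + 1` and `i`-coordinate in `[f i, f i + 1]`
(`j ≠ i`), so it is on the lattice edge between two corners of `f`, an edge of `Ω_δ`.
[cite: Smirnov2001, §2] -/
theorem mem_closure_of_on_side_data (hδ : 0 < δ) {f : Site 2} (hf : (⟨Dm.carrier, δ, arcA, arcB⟩ : DiscreteDobrushin).IsInnerFace f)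
    {z : ℂ} {i j : Fin 2} (hji : j ≠ i) {σ : ℕ} (hσ : σ ≤ 1)
    (hzj : coordVec (δ⁻¹ • z) j = f j + σ) (hz1 : (f i : ℝ) ≤ coordVec (δ⁻¹ • z) i)
    (hz2 : coordVec (δ⁻¹ • z) i ≤ f i + 1) : z ∈ closure Dm.carrier := by
  -- the corner `u` with `u i = f i`, `u j = f j + σ`, and `w = u + e_i`
  set u : Site 2 := f + (σ : ℤ) • Pi.single j 1 with hu
  have hui : u i = f i := by rw [hu, Pi.add_apply, Pi.smul_apply, Pi.single_eq_of_ne (Ne.symm hji)]; simp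
  have huj : u j = f j + σ := by rw [hu, Pi.add_apply, Pi.smul_apply, Pi.single_eq_same]; simp
  have hcu : IsCorner u f := by
    intro k; rcases fin_two_cases_of_ne hji k with rfl | rfl
    · exact Or.inl hui
    · rw [huj]; omega
  have hcw : IsCorner (u + Pi.single i 1) f := by
    intro k; rcases fin_two_cases_of_ne hji k with rfl | rfl
    · right; simp [hui]
    · rw [Pi.add_apply, Pi.single_eq_of_ne hji, add_zero, huj]; omega
  have hadj : (zdGraph 2).Adj u (u + Pi.single i 1) := (zdGraph_adj_iff _ _).2 ⟨i, Or.inl rfl⟩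
  have hmem : δ⁻¹ • z ∈ edgeTrace s(u, u + Pi.single i 1) := by
    refine mem_edgeTrace_single_iff.2 ⟨fun k hk => ?_, by rw [hui]; exact hz1, by rw [hui]; exact hz2⟩
    rcases fin_two_cases_of_ne hji k with rfl | rfl
    · exact absurd rfl hk
    · rw [huj, hzj]; push_cast; ring
  have hseg := segment_subset_closure_of_adj_data (hf u (u + Pi.single i 1) hcu hcw hadj)
  rw [meshPoint_eq_smul, meshPoint_eq_smul, ← smul_segment_eq] at hseg
  have : z ∈ δ • edgeTrace s(u, u + Pi.single i 1) := by
    rw [Set.mem_smul_set_iff_inv_smul_mem₀ hδ.ne']; exact hmem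
  rw [edgeTrace_mk] at this
  exact hseg this

/-- **Open inner faces lie in the domain** (arbitrary arcs; Jordan curve theorem, via
`JordanDomain.openRect_subset_of_sides_subset_closure`). [cite: Smirnov2001, §2] -/
theorem mem_carrier_of_mem_openSq_data (hδ : 0 < δ) {f : Site 2} (hf : (⟨Dm.carrier, δ, arcA, arcB⟩ : DiscreteDobrushin).IsInnerFace f)
    {z : ℂ} (hz : δ⁻¹ • z ∈ openSq f) : z ∈ Dm.carrier :=
  -- `IsInnerFace`/`openSq` only see `carrier` and `δ`, so the fixed-arc statement applies verbatim
  -- (librarian dedup-01707)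
  mem_carrier_of_mem_openSq hδ hf hz

/-- **The crossing point of a vertex connector lies in the domain** (arbitrary arcs): the
`1 × 2` rectangle made of the two inner faces `fL` (below) and `fU` (above the crossed edge,
line `{x_J = g}`, column `a`) has its sides in `closure D`, so its interior lies in `D`; a point
of vertex-connector shape lies in that interior. [cite: Smirnov2001, §2] -/
theorem mem_carrier_of_vConnShape_data (hδ : 0 < δ) {fL fU : Site 2}
    (hL : (⟨Dm.carrier, δ, arcA, arcB⟩ : DiscreteDobrushin).IsInnerFace fL) (hU : (⟨Dm.carrier, δ, arcA, arcB⟩ : DiscreteDobrushin).IsInnerFace fU)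
    {I J : Fin 2} (hJI : J ≠ I) {a g : ℤ} (hLI : fL I = a) (hUI : fU I = a) (hLJ : fL J + 1 = g)
    (hUJ : fU J = g) {z : ℂ} (hz : VConnShape I J a g (δ⁻¹ • z)) : z ∈ Dm.carrier := by
  obtain ⟨-, hzi, hzj1, hzj2⟩ := hz
  have hLJ' : ((fL J : ℤ) : ℝ) = g - 1 := by
    have : ((fL J + 1 : ℤ) : ℝ) = g := by exact_mod_cast hLJ
    push_cast at this; linarith
  -- sides of the rectangle, in the coordinates `(I, J)`
  have hsideI : ∀ w : ℂ, (coordVec (δ⁻¹ • w) I = a ∨ coordVec (δ⁻¹ • w) I = a + 1) →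
      (g : ℝ) - 1 ≤ coordVec (δ⁻¹ • w) J → coordVec (δ⁻¹ • w) J ≤ g + 1 → w ∈ closure Dm.carrier := by
    intro w hwI hw1 hw2
    rcases le_total (coordVec (δ⁻¹ • w) J) g with hwg | hwg
    · -- on a side of `fL` (orthogonal to `J`... i.e. with constant `I`-coordinate)
      rcases hwI with hwI | hwI
      · exact mem_closure_of_on_side_data hδ hL (i := J) (j := I) (Ne.symm hJI) (σ := 0) (by norm_num)
          (by rw [hwI, hLI]; simp) (by rw [hLJ']; linarith) (by rw [hLJ']; linarith)
      · exact mem_closure_of_on_side_data hδ hL (i := J) (j := I) (Ne.symm hJI) (σ := 1) le_rfl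
          (by rw [hwI, hLI]; simp) (by rw [hLJ']; linarith) (by rw [hLJ']; linarith)
    · rcases hwI with hwI | hwI
      · exact mem_closure_of_on_side_data hδ hU (i := J) (j := I) (Ne.symm hJI) (σ := 0) (by norm_num)
          (by rw [hwI, hUI]; simp) (by rw [hUJ]; exact hwg) (by rw [hUJ]; exact hw2)
      · exact mem_closure_of_on_side_data hδ hU (i := J) (j := I) (Ne.symm hJI) (σ := 1) le_rfl
          (by rw [hwI, hUI]; simp) (by rw [hUJ]; exact hwg) (by rw [hUJ]; exact hw2)
  have hsideJ : ∀ w : ℂ, (coordVec (δ⁻¹ • w) J = g - 1 ∨ coordVec (δ⁻¹ • w) J = g + 1) →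
      (a : ℝ) ≤ coordVec (δ⁻¹ • w) I → coordVec (δ⁻¹ • w) I ≤ a + 1 → w ∈ closure Dm.carrier := by
    intro w hwJ hw1 hw2
    rcases hwJ with hwJ | hwJ
    · exact mem_closure_of_on_side_data hδ hL (i := I) (j := J) hJI (σ := 0) (by norm_num)
        (by rw [hwJ, hLJ']; push_cast; ring) (by rw [hLI]; exact hw1) (by rw [hLI]; exact hw2)
    · exact mem_closure_of_on_side_data hδ hU (i := I) (j := J) hJI (σ := 1) le_rfl
        (by rw [hwJ, hUJ]; push_cast; ring) (by rw [hUI]; exact hw1) (by rw [hUI]; exact hw2)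
  -- read in `re`/`im`
  have hcoord : ∀ (w : ℂ) (k : Fin 2), coordVec (δ⁻¹ • w) k = δ⁻¹ * coordVec w k := fun w k => by
    rcases fin_two_eq_zero_or_one k with rfl | rfl <;> simp
  have hzI' : (a : ℝ) < coordVec (δ⁻¹ • z) I ∧ coordVec (δ⁻¹ • z) I < a + 1 := by
    rcases hzi with h | h <;> rw [h] <;> constructor <;> linarith
  have hzJ' : (g : ℝ) - 1 < coordVec (δ⁻¹ • z) J ∧ coordVec (δ⁻¹ • z) J < g + 1 := by
    constructor <;> linarith
  rcases fin_two_eq_other hJI with ⟨rfl, rfl⟩ | ⟨rfl, rfl⟩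
  · -- `I = 0`: rectangle `(δa, δ(a+1)) × (δ(g-1), δ(g+1))`
    have key := Dm.openRect_subset_of_sides_subset_closure (x₁ := δ * a) (x₂ := δ * (a + 1))
      (y₁ := δ * (g - 1)) (y₂ := δ * (g + 1)) ?_ ?_
    · apply key
      simp only [hcoord, coordVec_zero, coordVec_one] at hzI' hzJ'
      refine ⟨⟨?_, ?_⟩, ?_, ?_⟩
      · have := mul_lt_mul_of_pos_left hzI'.1 hδ; rwa [mul_inv_cancel_left₀ hδ.ne'] at this
      · have := mul_lt_mul_of_pos_left hzI'.2 hδ; rwa [mul_inv_cancel_left₀ hδ.ne'] at this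
      · have := mul_lt_mul_of_pos_left hzJ'.1 hδ; rwa [mul_inv_cancel_left₀ hδ.ne'] at this
      · have := mul_lt_mul_of_pos_left hzJ'.2 hδ; rwa [mul_inv_cancel_left₀ hδ.ne'] at this
    · intro w hw h1 h2
      refine hsideI w ?_ ?_ ?_
      · rcases hw with hw | hw
        · left; rw [hcoord, coordVec_zero, hw]; field_simp
        · right; rw [hcoord, coordVec_zero, hw]; field_simp
      · rw [hcoord, coordVec_one, le_inv_mul_iff₀ hδ]; exact h1
      · rw [hcoord, coordVec_one, inv_mul_le_iff₀ hδ]; exact h2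
    · intro w hw h1 h2
      refine hsideJ w ?_ ?_ ?_
      · rcases hw with hw | hw
        · left; rw [hcoord, coordVec_one, hw]; field_simp
        · right; rw [hcoord, coordVec_one, hw]; field_simp
      · rw [hcoord, coordVec_zero, le_inv_mul_iff₀ hδ]; exact h1
      · rw [hcoord, coordVec_zero, inv_mul_le_iff₀ hδ]; exact h2
  · -- `I = 1`: rectangle `(δ(g-1), δ(g+1)) × (δa, δ(a+1))`
    have key := Dm.openRect_subset_of_sides_subset_closure (x₁ := δ * (g - 1)) (x₂ := δ * (g + 1))
      (y₁ := δ * a) (y₂ := δ * (a + 1)) ?_ ?_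
    · apply key
      simp only [hcoord, coordVec_zero, coordVec_one] at hzI' hzJ'
      refine ⟨⟨?_, ?_⟩, ?_, ?_⟩
      · have := mul_lt_mul_of_pos_left hzJ'.1 hδ; rwa [mul_inv_cancel_left₀ hδ.ne'] at this
      · have := mul_lt_mul_of_pos_left hzJ'.2 hδ; rwa [mul_inv_cancel_left₀ hδ.ne'] at this
      · have := mul_lt_mul_of_pos_left hzI'.1 hδ; rwa [mul_inv_cancel_left₀ hδ.ne'] at this
      · have := mul_lt_mul_of_pos_left hzI'.2 hδ; rwa [mul_inv_cancel_left₀ hδ.ne'] at this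
    · intro w hw h1 h2
      refine hsideJ w ?_ ?_ ?_
      · rcases hw with hw | hw
        · left; rw [hcoord, coordVec_zero, hw]; field_simp
        · right; rw [hcoord, coordVec_zero, hw]; field_simp
      · rw [hcoord, coordVec_one, le_inv_mul_iff₀ hδ]; exact h1
      · rw [hcoord, coordVec_one, inv_mul_le_iff₀ hδ]; exact h2
    · intro w hw h1 h2
      refine hsideI w ?_ ?_ ?_
      · rcases hw with hw | hw
        · left; rw [hcoord, coordVec_one, hw]; field_simp
        · right; rw [hcoord, coordVec_one, hw]; field_simp
      · rw [hcoord, coordVec_zero, le_inv_mul_iff₀ hδ]; exact h1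
      · rw [hcoord, coordVec_zero, inv_mul_le_iff₀ hδ]; exact h2

/-- **The perturbed polygon lies in the domain** (arbitrary arcs). [cite: Smirnov2001, §2] -/
theorem pertTrace_subset_carrier_data (hδ : 0 < δ)
    (hexp : IsMedialExploration (⟨Dm.carrier, δ, arcA, arcB⟩ : DiscreteDobrushin) ω (a :: l)) :
    hexp.pertTrace ⊆ Dm.carrier := by
  intro z hz
  have hδ' : 0 < (⟨Dm.carrier, δ, arcA, arcB⟩ : DiscreteDobrushin).δ := hδ
  rcases hexp.mem_pertTrace_iff.1 hz with ⟨i, hi, hzi⟩ | ⟨i, ⟨hi1, hi⟩, hzi⟩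
  · rw [hexp.dartPiece_eq, Set.mem_smul_set_iff_inv_smul_mem₀ hδ'.ne'] at hzi
    exact mem_carrier_of_mem_openSq_data hδ (hexp.isInnerFace hi)
      (dartSeg_subset_openSq (hexp.isCorner hi) hzi)
  · rcases hexp.connPiece_cases hi1 hi hδ' hzi with
      ⟨I, J, hJI, -, -, hcol, hside, -, hshape⟩ | ⟨I, J, hJI, -, -, -, -, hshape, -, -⟩
    · dsimp only at hshape
      rcases hside with ⟨h1, h2⟩ | ⟨h1, h2⟩
      · exact mem_carrier_of_vConnShape_data hδ (hexp.isInnerFace (by omega)) (hexp.isInnerFace hi)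
          hJI rfl hcol.symm h1 h2 hshape
      · exact mem_carrier_of_vConnShape_data hδ (hexp.isInnerFace hi) (hexp.isInnerFace (by omega))
          hJI hcol.symm rfl h2 h1 hshape
    · refine mem_carrier_of_mem_openSq_data hδ (hexp.isInnerFace hi) fun k => ?_
      obtain ⟨-, ⟨h1, h2⟩, h3⟩ := hshape
      dsimp only at h1 h2 h3
      rcases fin_two_cases_of_ne hJI k with rfl | rfl
      · constructor <;> linarith
      · rcases h3 with h | h <;> rw [h] <;> constructor <;> linarith

/-- The perturbed polygon misses the boundary curve (arbitrary arcs). [cite: Smirnov2001, §2] -/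
theorem pertTrace_disjoint_frontier_data (hδ : 0 < δ)
    (hexp : IsMedialExploration (⟨Dm.carrier, δ, arcA, arcB⟩ : DiscreteDobrushin) ω (a :: l)) :
    Disjoint hexp.pertTrace (frontier Dm.carrier) :=
  Set.disjoint_left.2 fun _ hz hz' =>
    Set.disjoint_left.1 Dm.disjoint_carrier_frontier (pertTrace_subset_carrier_data hδ hexp hz) hz'

/-! ### From the discrete boundary to the boundary curve, off the polygon -/

/-- **From a discrete boundary site to the boundary curve, off the polygon** (arbitrary arcs).
Every site `u` of `∂Ω_δ` (`zdBoundary`) is joined to a point `z` of `∂D` with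
`dist (z, δu) ≤ 2δ` by a straight segment missing the perturbed polygon: along a lattice edge at
`u` which is not an edge of `Ω_δ` (it leaves `Ω̄`, or ends at a mesh point off `Ω`), or inside a
non-inner face at `u` (which contains a point off `Ω`, since otherwise all its sides would be
edges of `Ω_δ`). [cite: Smirnov2001, §2] -/
theorem exists_frontier_near_of_mem_zdBoundary_data (hδ : 0 < δ)
    (hexp : IsMedialExploration (⟨Dm.carrier, δ, arcA, arcB⟩ : DiscreteDobrushin) ω (a :: l)) {u : Site 2}
    (hu : u ∈ (⟨Dm.carrier, δ, arcA, arcB⟩ : DiscreteDobrushin).zdBoundary) :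
    ∃ z ∈ frontier Dm.carrier, dist z (meshPoint δ u) ≤ 2 * δ ∧
      ∀ q ∈ segment ℝ (meshPoint δ u) z, q ∉ hexp.pertTrace := by
  have hδ' : 0 < (⟨Dm.carrier, δ, arcA, arcB⟩ : DiscreteDobrushin).δ := hδ
  have huΩ : meshPoint δ u ∈ Dm.carrier :=
    meshDomain_subset_meshVertices _ _ ((⟨Dm.carrier, δ, arcA, arcB⟩ : DiscreteDobrushin).zdBoundary_subset_meshDomain hu)
  -- frontier point on a segment from `δu` to a point off `Ω`
  have cross : ∀ {q : ℂ}, q ∉ Dm.carrier → ∃ z ∈ segment ℝ (meshPoint δ u) q, z ∈ frontier Dm.carrier := by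
    intro q hq
    obtain ⟨z, hz1, hz2⟩ := Dm.inter_frontier_nonempty_of_isPreconnected
      (convex_segment (meshPoint δ u) q).isPreconnected ⟨_, left_mem_segment _ _ _, huΩ⟩
      ⟨q, right_mem_segment _ _ _, hq⟩
    exact ⟨z, hz1, hz2⟩
  rcases (⟨Dm.carrier, δ, arcA, arcB⟩ : DiscreteDobrushin).mem_zdBoundary_iff.1 hu with hu' | ⟨y, hadj, -, g, hg, hug, hyg⟩
  · -- `u ∈ meshBoundary`: a lattice neighbour `y` not `Ω_δ`-adjacent
    obtain ⟨huD, y, hzd, hnadj⟩ := mem_meshBoundary_iff.1 hu'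
    have hfree : ∀ q ∈ segment ℝ (meshPoint δ u) (meshPoint δ y), q ∉ hexp.pertTrace := by
      intro q hq hqt
      rw [meshPoint_eq_smul, meshPoint_eq_smul, mem_segment_smul_iff hδ.ne'] at hq
      obtain ⟨i, hi, -, hsrc, -⟩ := hexp.edge_of_mem_edgeTrace hδ' hzd hqt hq
      exact hnadj (adj_of_eq_cornerSource hexp hi.2 hsrc)
    have hdist : dist (meshPoint δ y) (meshPoint δ u) = δ := by
      rw [dist_comm, dist_meshPoint_of_adj hzd, abs_of_pos hδ]
    by_cases hseg : segment ℝ (meshPoint δ u) (meshPoint δ y) ⊆ closure Dm.carrier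
    · -- then `δy ∉ Ω` (else `y ∈ Ω_δ`), so `δy ∈ ∂Ω`
      have hyΩ : meshPoint δ y ∉ Dm.carrier := by
        intro hyΩ
        apply hnadj
        rw [discreteDomainGraph_adj_iff]
        have hmesh : (meshGraph (⟨Dm.carrier, δ, arcA, arcB⟩ : DiscreteDobrushin).Ω (⟨Dm.carrier, δ, arcA, arcB⟩ : DiscreteDobrushin).δ).Adj u y :=
          meshGraph_adj_iff.2 ⟨hzd, hseg⟩
        exact ⟨hmesh, huD, mem_meshDomain_of_meshGraph_adj huD hyΩ hmesh⟩
      refine ⟨meshPoint δ y, ⟨hseg (right_mem_segment _ _ _), ?_⟩, hdist.le.trans (by linarith), hfree⟩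
      rw [Dm.isOpen.interior_eq]; exact hyΩ
    · obtain ⟨q, hq, hqΩ⟩ := not_subset.1 hseg
      obtain ⟨z, hz, hzfr⟩ := cross (fun h => hqΩ (subset_closure h))
      have hsub : segment ℝ (meshPoint δ u) z ⊆ segment ℝ (meshPoint δ u) (meshPoint δ y) :=
        (convex_segment _ _).segment_subset (left_mem_segment _ _ _)
          ((convex_segment _ _).segment_subset (left_mem_segment _ _ _) hq hz)
      refine ⟨z, hzfr, ?_, fun p hp => hfree p (hsub hp)⟩
      have hzball : z ∈ closedBall (meshPoint δ u) δ :=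
        (convex_closedBall _ _).segment_subset (mem_closedBall.2 (by rw [dist_self]; exact hδ.le)) (mem_closedBall.2 hdist.le) (hsub (right_mem_segment _ _ _))
      rw [mem_closedBall] at hzball; linarith
  · -- `u` is a corner of a non-inner face `g`: some point of `g` is off `Ω`
    have huD : u ∈ meshDomain (⟨Dm.carrier, δ, arcA, arcB⟩ : DiscreteDobrushin).Ω (⟨Dm.carrier, δ, arcA, arcB⟩ : DiscreteDobrushin).δ :=
      (discreteDomainGraph_adj_iff.1 hadj).2.1
    have hsq : ∃ q ∈ δ • closedSq g, q ∉ Dm.carrier := by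
      by_contra hall
      push Not at hall
      apply hg
      -- all corners are mesh vertices, all sides are mesh edges: `g` is inner
      have hvert : ∀ v, IsCorner v g → meshPoint δ v ∈ Dm.carrier := fun v hv =>
        hall _ (by rw [meshPoint_eq_smul]; exact Set.smul_mem_smul_set (toComplex_mem_closedSq hv))
      have hmesh : ∀ v w, IsCorner v g → IsCorner w g → (zdGraph 2).Adj v w →
          (meshGraph (⟨Dm.carrier, δ, arcA, arcB⟩ : DiscreteDobrushin).Ω (⟨Dm.carrier, δ, arcA, arcB⟩ : DiscreteDobrushin).δ).Adj v w := by
        intro v w hv hw hvw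
        refine meshGraph_adj_iff.2 ⟨hvw, fun p hp => subset_closure (hall p ?_)⟩
        rw [meshPoint_eq_smul, meshPoint_eq_smul, ← smul_segment_eq] at hp
        obtain ⟨p', hp', rfl⟩ := hp
        exact Set.smul_mem_smul_set ((convex_closedSq g).segment_subset (toComplex_mem_closedSq hv)
          (toComplex_mem_closedSq hw) hp')
      have hdom : ∀ v, IsCorner v g → v ∈ meshDomain (⟨Dm.carrier, δ, arcA, arcB⟩ : DiscreteDobrushin).Ω (⟨Dm.carrier, δ, arcA, arcB⟩ : DiscreteDobrushin).δ := by
        intro v hv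
        rcases IsCorner.exists_adj_chain hug hv with rfl | h | ⟨c, hc, h1, h2⟩
        · exact huD
        · exact mem_meshDomain_of_meshGraph_adj huD (hvert v hv) (hmesh _ _ hug hv h)
        · exact mem_meshDomain_of_meshGraph_adj (mem_meshDomain_of_meshGraph_adj huD (hvert c hc) (hmesh _ _ hug hc h1))
            (hvert v hv) (hmesh _ _ hc hv h2)
      intro v w hv hw hvw
      exact discreteDomainGraph_adj_iff.2 ⟨hmesh v w hv hw hvw, hdom v hv, hdom w hw⟩
    obtain ⟨q, hq, hqΩ⟩ := hsq
    obtain ⟨z, hz, hzfr⟩ := cross hqΩ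
    have husq : meshPoint δ u ∈ δ • closedSq g := by
      rw [meshPoint_eq_smul]; exact Set.smul_mem_smul_set (toComplex_mem_closedSq hug)
    have hconv : Convex ℝ (δ • closedSq g) := (convex_closedSq g).smul δ
    have hsub : segment ℝ (meshPoint δ u) z ⊆ δ • closedSq g :=
      hconv.segment_subset husq (hconv.segment_subset husq hq hz)
    refine ⟨z, hzfr, ?_, fun p hp hpt => ?_⟩
    · have := closedSq_subset_closedBall hug ((Set.mem_smul_set_iff_inv_smul_mem₀ hδ.ne' _ _).1
        (hsub (right_mem_segment _ _ _)))
      rw [mem_closedBall, ← mul_le_mul_iff_right₀ hδ, ← abs_of_pos hδ, ← Real.norm_eq_abs, ← dist_smul₀,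
        Real.norm_eq_abs, abs_of_pos hδ, smul_inv_smul₀ hδ.ne', ← meshPoint_eq_smul] at this
      linarith
    · exact hg (hexp.isInnerFace_of_mem_closedSq hδ' hpt
        ((Set.mem_smul_set_iff_inv_smul_mem₀ hδ.ne' _ _).1 (hsub hp)))

end Literature.Probability.Percolation

end
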